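import Literature.Claims.NS.McSheery2026

/-!
# C132 `McSheery2026` — kernel certificates on the artefact's transcribed solution notion (refuter file)

Row C132 of cell `ns-claims` (D-0090): T. McSheery, GitHub `tracyphasespace/NavierStokes` @ `551044eaba19`
(Lean-4 artefact; README «Purpose: CMI Millennium Prize Submission · Status: ✅ COMPLETE»; capstone
`CMI_global_regularity`, `Lean/Phase7_Density/CMI_Regularity.lean` l.80–103, «THE CLAY MILLENNIUM PRIZE THEOREM — 0
CUSTOM AXIOMS»; printed Thm 3.4.1 `docs/CMI_Combined_Papers` p.16). Skeleton `Literature.Claims.NS.McSheery2026`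
(typist-3 g3, p493123) transcribes the artefact's vocabulary VERBATIM and proves `TestFunction.val_eq_zero` (the
test space is `{0}`: `ContDiff ℝ ⊤` = analytic, + compact support), `isWeakNSSolution_iff_continuous`,
`artefactConclusion_holds`, `step_bridge_iff_clay`.

This file adds the refuter's checks of the TOP STATEMENT's type (artefact treatment, RULINGS v1.30k), all on the
verbatim transcription and with standard axioms:

* **Grain-independent emptiness (kills the charitable re-typing of the test space).** The capstone's conclusion
  `∃ u, u 0 = u₀ 0 ∧ IsWeakNSSolution u ν` does not become contentful when `TestFunction` is re-typed with genuine
  `C^∞` compactly supported divergence-free fields: for EVERY family `𝒯` of test fields whatsoever, the «flash»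
  field `flash u₀ t := if t = 0 then u₀ 0 else 0` has the prescribed datum, is continuous in `x` at every `t`, and
  makes all three integral terms vanish for every `φ` (`timeDerivTerm_flash`, `advectionTerm_flash`,
  `viscosityTerm_flash`: the `t`-integrands vanish off the null slice `t = 0`), hence satisfies the weak identity
  against every `φ ∈ 𝒯` (`artefactConclusion_holds_anyTests`). The defect certified here is Δ2/Δ5 of the TYPE
  itself — time axis `ℝ`, datum entering only as the pointwise value `u 0 = u₀ 0`, no time regularity / initial
  trace — not the `ω`-accident of the smoothness exponent.
* **Δ5/Δ2 on the verbatim notion**: the linear field `u t x = x` (divergence `3`, infinite energy) is an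
  `IsWeakNSSolution` for every `ν`, including `ν = −1` (`isWeakNSSolution_linear`); with one datum both the frozen
  field and the flash field are «solutions», distinct at every `t ≠ 0` (`not_unique`).
* **Hypothesis smuggles nothing**: the capstone's hypotheses (`CapstoneHypotheses`, the used fields of
  `ScleronomicKineticEvolution`) are inhabited over the flash field (`capstoneHypotheses_flash`).

Class proposal (cell vocabulary, RULINGS v1.26 (1) case (β) — the deposit IDENTIFIES its checked TYPE with the
Clay sentence): first failing step = STATEMENT = `Literature.Claims.NS.McSheery2026.Step_bridge`, class = wrong
problem (Δ5 solution notion decisive; Δ2, Δ4, Δ6), by `artefactConclusion_holds` + `step_bridge_iff_clay`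
p493123 and the certificates below. Refuter of record ns-claims-refuter-4 g0.
WHAT THIS IS NOT: not a claim about NS regularity or blow-up; not a claim about any author beyond the typed
locator.
-/

set_option linter.dupNamespace false

noncomputable section

open Set MeasureTheory Filter Topology Function

namespace Summit.NavierStokesRegularity.NavierStokesRegularity.Theorems.McSheery2026

open Literature.Claims.NS.McSheery2026

/-! ## The flash field -/

/-- The «flash» field: the datum at `t = 0`, zero at every other time. [folklore] -/
def flash (u₀ : VelocityField) : VelocityField := fun t x => if t = 0 then u₀ 0 x else 0

/-- The flash field carries the prescribed datum. [folklore] -/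
theorem flash_zero (u₀ : VelocityField) : flash u₀ 0 = u₀ 0 := by
  funext x; simp [flash]

/-- Off `t = 0` the flash field vanishes. [folklore] -/
theorem flash_of_ne {u₀ : VelocityField} {t : ℝ} (ht : t ≠ 0) : flash u₀ t = fun _ => 0 := by
  funext x; simp [flash, ht]

/-- The flash field is continuous in `x` at every time, as soon as the datum is. [folklore] -/
theorem continuous_flash {u₀ : VelocityField} (h : Continuous (u₀ 0)) (t : ℝ) : Continuous (flash u₀ t) := by
  by_cases ht : t = 0
  · subst ht; rw [flash_zero]; exact h
  · rw [flash_of_ne ht]; exact continuous_const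

/-- Almost every time is non-zero (Lebesgue). [folklore] -/
theorem ae_ne_zero : ∀ᵐ t ∂(volume : Measure ℝ), t ≠ 0 := by
  rw [ae_iff]
  simp

/-- The time-derivative pairing of the flash field vanishes for EVERY `φ`. [folklore] -/
theorem timeDerivTerm_flash (u₀ : VelocityField) (φ : ℝ → Position → Position) :
    timeDerivTerm (flash u₀) φ = 0 := by
  unfold timeDerivTerm
  apply integral_eq_zero_of_ae
  filter_upwards [ae_ne_zero] with t ht
  simp [flash_of_ne ht]

/-- The advection pairing of the flash field vanishes for EVERY `φ`. [folklore] -/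
theorem advectionTerm_flash (u₀ : VelocityField) (φ : ℝ → Position → Position) :
    advectionTerm (flash u₀) φ = 0 := by
  unfold advectionTerm
  apply integral_eq_zero_of_ae
  filter_upwards [ae_ne_zero] with t ht
  simp [flash_of_ne ht]

/-- The viscosity pairing of the flash field vanishes for EVERY `φ`. [folklore] -/
theorem viscosityTerm_flash (u₀ : VelocityField) (φ : ℝ → Position → Position) :
    viscosityTerm (flash u₀) φ = 0 := by
  unfold viscosityTerm
  apply integral_eq_zero_of_ae
  filter_upwards [ae_ne_zero] with t ht
  simp [flash_of_ne ht]

/-- The flash field satisfies the artefact's weak identity against EVERY field `φ`, for every `ν`. [folklore] -/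
theorem weakIdentity_flash (u₀ : VelocityField) (ν : ℝ) (φ : ℝ → Position → Position) :
    timeDerivTerm (flash u₀) φ + advectionTerm (flash u₀) φ = ν * viscosityTerm (flash u₀) φ := by
  rw [timeDerivTerm_flash, advectionTerm_flash, viscosityTerm_flash]; ring

/-- The flash field is an `IsWeakNSSolution` (verbatim notion) for every `ν`. [cite: McSheery2026, Lean/Phase7_Density/PhysicsAxioms.lean l.113–121] -/
theorem isWeakNSSolution_flash {u₀ : VelocityField} (h : Continuous (u₀ 0)) (ν : ℝ) :
    IsWeakNSSolution (flash u₀) ν :=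
  ⟨continuous_flash h, fun φ => weakIdentity_flash u₀ ν φ.val⟩

/-! ## Grain-independent emptiness of the capstone's conclusion -/

/-- **The capstone's conclusion holds for EVERY family of test fields** (so also after re-typing `TestFunction`
with genuine `C^∞` compactly supported divergence-free fields): for every `𝒯`, every `ν` and every datum with
`u₀ 0` continuous there is `u` with `u 0 = u₀ 0`, continuous in `x` at each time, satisfying the weak identity
against every `φ ∈ 𝒯` — the flash field. The time axis is `ℝ`, the datum is a pointwise value at `t = 0`, and the
integrals do not see a null time slice. [cite: McSheery2026, Lean/Phase7_Density/CMI_Regularity.lean l.100–102; Lean/Phase7_Density/PhysicsAxioms.lean l.83–121] -/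
theorem artefactConclusion_holds_anyTests (𝒯 : Set (ℝ → Position → Position)) (ν : ℝ) (u₀ : VelocityField)
    (h : Continuous (u₀ 0)) :
    ∃ u : VelocityField, u 0 = u₀ 0 ∧ (∀ t, Continuous (u t)) ∧
      ∀ φ ∈ 𝒯, timeDerivTerm u φ + advectionTerm u φ = ν * viscosityTerm u φ :=
  ⟨flash u₀, flash_zero u₀, continuous_flash h, fun φ _ => weakIdentity_flash u₀ ν φ⟩

/-- In particular the verbatim conclusion `ArtefactConclusion ν u₀` is witnessed by the flash field as well
(second witness next to the skeleton's frozen field). [cite: McSheery2026, Lean/Phase7_Density/CMI_Regularity.lean l.100–102] -/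
theorem artefactConclusion_by_flash (ν : ℝ) (u₀ : VelocityField) (h : Continuous (u₀ 0)) :
    ArtefactConclusion ν u₀ :=
  ⟨flash u₀, flash_zero u₀, isWeakNSSolution_flash h ν⟩

/-! ## Δ5 / Δ2 certificates on the verbatim solution notion -/

/-- **The linear field `u(t, x) = x` is a «weak NS solution» of the artefact for every `ν`** (also `ν = −1`): it has
divergence `3` and infinite energy — the notion contains no incompressibility of `u`, no energy class, no sign of
the viscosity. [cite: McSheery2026, Lean/Phase7_Density/PhysicsAxioms.lean l.113–121] -/
theorem isWeakNSSolution_linear (ν : ℝ) : IsWeakNSSolution (fun _ x => x) ν :=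
  (isWeakNSSolution_iff_continuous _ ν).2 fun _ => continuous_id

/-- The divergence of the linear field is `3 ≠ 0` at every point, in the artefact's own `fderiv` vocabulary
(`DivergenceFree` fails). [cite: McSheery2026, Lean/Phase7_Density/PhysicsAxioms.lean l.60–62] -/
theorem not_divergenceFree_linear : ¬ DivergenceFree (fun (_ : ℝ) (x : Position) => x) := by
  intro h
  have h0 := h 0 0
  have hd : ∀ i : Fin 3, fderiv ℝ (fun y : Position => y i) 0 (EuclideanSpace.single i 1) = 1 := by
    intro i
    have hda : HasFDerivAt (fun y : Position => y i) (EuclideanSpace.proj i : Position →L[ℝ] ℝ) 0 :=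
      (EuclideanSpace.proj i : Position →L[ℝ] ℝ).hasFDerivAt
    rw [hda.fderiv]
    simp
  simp only [hd, Finset.sum_const, Finset.card_univ, Fintype.card_fin] at h0
  norm_num at h0

/-- **Non-uniqueness inside the notion**: for a datum with `u₀ 0 ≠ 0` the frozen field and the flash field are two
«weak NS solutions» with the same datum that differ at every time `t ≠ 0`. [cite: McSheery2026, Lean/Phase7_Density/PhysicsAxioms.lean l.113–121] -/
theorem not_unique {u₀ : VelocityField} (h : Continuous (u₀ 0)) (h0 : u₀ 0 ≠ 0) (ν : ℝ) :
    ∃ u u' : VelocityField, u 0 = u₀ 0 ∧ u' 0 = u₀ 0 ∧ IsWeakNSSolution u ν ∧ IsWeakNSSolution u' ν ∧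
      ∀ t ≠ 0, u t ≠ u' t :=
  ⟨fun _ => u₀ 0, flash u₀, rfl, flash_zero u₀, (isWeakNSSolution_iff_continuous _ ν).2 fun _ => h,
    isWeakNSSolution_flash h ν, fun t ht => by rw [flash_of_ne ht]; exact fun e => h0 e⟩

/-! ## The capstone's hypotheses are inhabited over the flash field -/

/-- **The used hypotheses of `ScleronomicKineticEvolution` (transcribed as `CapstoneHypotheses`) hold over the
flash field**, with the auxiliary functionals read off from the identity (`stress := −timeDerivTerm`,
`reynolds := advectionTerm`, `deviation := −ν·viscosityTerm`, `transpose := 0`): the hypothesis bundle excludes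
nothing. [cite: McSheery2026, Lean/Phase7_Density/PhysicsAxioms.lean l.525–545, l.558–611] -/
theorem capstoneHypotheses_flash (ν : ℝ) {u₀ : VelocityField} (h : Continuous (u₀ 0)) :
    ∃ X : CapstoneData, X.v = flash u₀ ∧ CapstoneHypotheses ν u₀ X := by
  refine ⟨⟨flash u₀, fun φ => -timeDerivTerm (flash u₀) φ, fun φ => advectionTerm (flash u₀) φ,
    fun φ => -(ν * viscosityTerm (flash u₀) φ), fun _ => 0⟩, rfl, ?_⟩
  exact
    { h_initial := flash_zero u₀
      h_vel_continuous := continuous_flash h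
      time_deriv_to_stress := fun φ => by simp
      stress_splits := fun φ => by
        simp [timeDerivTerm_flash, advectionTerm_flash, viscosityTerm_flash]
      advection_from_reynolds := fun φ => rfl
      deviation_to_viscous := fun φ => by simp
      transpose_vanishes := fun φ => rfl }

/-- Summary conjunction for the record: grain-independent emptiness, a compressible «solution», non-uniqueness of
the notion, and the bridge = Clay (A) itself (skeleton). [cite: McSheery2026, Lean/Phase7_Density/CMI_Regularity.lean l.80–103] -/
theorem topStatement_certificates :
    (∀ 𝒯 : Set (ℝ → Position → Position), ∀ ν : ℝ, ∀ u₀ : VelocityField, Continuous (u₀ 0) →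
        ∃ u : VelocityField, u 0 = u₀ 0 ∧ (∀ t, Continuous (u t)) ∧
          ∀ φ ∈ 𝒯, timeDerivTerm u φ + advectionTerm u φ = ν * viscosityTerm u φ) ∧
      (∀ ν : ℝ, IsWeakNSSolution (fun _ x => x) ν) ∧ ¬ DivergenceFree (fun (_ : ℝ) (x : Position) => x) ∧
      (Step_bridge ↔ Literature.Claims.NS.ClayVariants.clayR3.Regularity) :=
  ⟨artefactConclusion_holds_anyTests, isWeakNSSolution_linear, not_divergenceFree_linear, step_bridge_iff_clay⟩

end Summit.NavierStokesRegularity.NavierStokesRegularity.Theorems.McSheery2026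

end
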